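/-
Copyright (c) 2026 the pub-hodgecm-mathlib formalisation cell (harness21).  Prover seat hodgecm-mathlib-LA5-p02 (g2); L8-PREP road B,
organ B1 brick (D3) «fibre uniformisation immersion» (LA7-plan (g2) deal 2026-09-02T04:19:24Z).  KERNEL: theorems only.
-/
import Literature.Geometry.ComplexAnalytic.RelativeExponentialUniformisation
import Literature.NumberTheory.Transcendental.AnalytificationMorphismSmooth
import Literature.AlgebraicGeometry.HodgeTheory.AnalytificationImmersiveClosedImmersion
import Literature.AlgebraicGeometry.HodgeTheory.AbelianVarietyUniformisationOfIntegralFrame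
import Literature.AlgebraicGeometry.AbelianSchemes.FibreHomPointsOfFibrePoints
import Literature.AlgebraicGeometry.AbelianSchemes.LevelStructureRefinement
import HarnessLib

/-!
# The fibre of an analytified abelian scheme is uniformised by a holomorphic immersion `ℂ^g → A^an` with kernel a full lattice
# ([MumfordAV1970] §1 (1)–(2); [SerreGAGA1956] §2 n°6 Prop. 3 Cor. 2; [DeligneHodgeII1971] §4.4 (4.4.2))

Layer `Literature/Geometry/ComplexAnalytic`, namespace `Literature.Geometry.ComplexAnalytic`.  THEOREMS ONLY (no definition, no named fact,
no instance, no notation, no `sorry`).  Cell `hodgecm-mathlib`, L8-PREP (HOME-only prep for the E-line's printed residue P-1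
`relativeExponentialUniformisation`), road B (LA7-plan (g2) skeleton `StubFLOW.roadB`), organ B1 «DOUBLING», brick **(D3)**: the `∀ u`-tail of
`RoadB.DOUBLING` minus its two `two`∕`zero` clauses.

For the prefix of P-1 (★ `relativeExponentialUniformisation` :282–:289: a smooth separated `ℂ`-scheme `S` of relative dimension `d`, an abelian
scheme `A → S` of relative dimension `g`, analytifications `φS : MS → S(ℂ)`, `φA : MA → A(ℂ)` with holomorphic atlases) and a point `u : MS`,
the fibre `A_{φS u}` (a complex abelian variety of dimension `g`) is uniformised INSIDE `MA`: there are a real frame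
`Φ₀ : ℝ^{Fin g ⊕ Fin g} ≃ ℂ^g`, a map `π : ℂ^g → MA` and an additive analytification `φu : ComplexTorus Φ₀ → A_{φS u}(ℂ)` with `π` holomorphic with
injective differential (an immersion), over `u`, kernel EXACTLY `Φ₀ (ℤ^{2g})`, onto the fibre of `basePoint` over `u`, and reading
`(φA (π z)).left = fibrePointToLeft _ (φu (cover Φ₀ z))`.

CONSTRUCTION (all inputs ★): `Φ₀, φu` = ★ (U) `complexAbelianVariety_torusUniformised_holds` for the fibre, RE-INDEXED to `Fin g ⊕ Fin g`
(★ `exists_basis_integralLattice_map_eq_latticeClass` + `Module.Basis.reindex` along `Fintype.equivOfCardEq`, ★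
`AbelianVariety.exists_uniformisation_of_basis_integralLattice`; `dim A_{φS u} = g` by ★ `dim_toAbelianVariety_of_isOfRelDim`); `π :=
φA⁻¹ ∘ τ(ℂ) ∘ φu ∘ cover Φ₀` with `τ : A_{φS u} ⟶ A` the fibre inclusion over `Spec ℂ` (`Over.homMk (pullback.fst _ _)`), a closed immersion
(base change of the `ℂ`-point `φS u : Spec ℂ → S`, itself a closed immersion since `S` is separated: Mathlib `IsClosedImmersion.of_comp`);
holomorphy ★ `IsAnalytification.contMDiff_comp_map` + ★ `mdifferentiable_cover`; immersion ★ `IsAnalytification.injective_mfderiv_of_isClosedImmersion`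
+ ★ `mfderiv_cover = id`; over `u` by ★ `apply_basePoint`; kernel ★ `cover_eq_cover_iff` + ★ `fibrePointToLeft_injective`; onto by ★
`exists_points_fibrePointToLeft_eq` + `φu`, `cover` surjective.

* §1 `isClosedImmersion_left_of_complexPoint` (a `ℂ`-point of a separated `ℂ`-scheme is a closed immersion); `fibreIncl` data as theorems:
  `exists_fibre_uniformisation_finSum` (the fibre's torus uniformisation indexed by `Fin g ⊕ Fin g`).
* §2 **`exists_fibre_uniformisation_immersion`** — (D3).

HC_CM is proved only modulo the 7 printed citations until rung 0 closes; nothing here bears on a summit statement (count-neutral capital).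

## References
* [MumfordAV1970] D. Mumford, *Abelian Varieties* (1970), §1 (1)–(2) (complex tori), §4 (iv).
* [SerreGAGA1956] J.-P. Serre, *Géométrie algébrique et géométrie analytique*, Ann. Inst. Fourier 6 (1956), §2 n°5 Prop. 2, n°6 Prop. 3 Cor. 2.
* [DeligneHodgeII1971] P. Deligne, *Théorie de Hodge II*, Publ. Math. IHÉS 40 (1971), §4.4 (4.4.2) p. 50.
* [GortzWedhorn2020] U. Görtz, T. Wedhorn, *Algebraic Geometry I*, 2nd ed. (2020), Section (4.7) (pp. 107–108), (9.3) Remark 9.11–Example 9.12.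
-/

set_option autoImplicit false

noncomputable section

open scoped Manifold ContDiff Topology
open Set Function CategoryTheory CategoryTheory.Limits AlgebraicGeometry
open Literature.Geometry.Kaehler (ComplexTorus)
open Literature.Geometry.Kaehler.ComplexTorus (cover latticeVec cover_surjective mdifferentiable_cover mfderiv_cover cover_eq_cover_iff)
open Literature.NumberTheory.Transcendental (IsAnalytification)
open Literature.AlgebraicGeometry.Motives (SchemeOver AlgPoints ComplexPoints AbelianVariety)
open Literature.NumberTheory.Transcendental (specOver_self_hom)
open Literature.AlgebraicGeometry.AbelianSchemes (AbelianSchemeOver)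

namespace Literature.Geometry.ComplexAnalytic

/-! ## §1 Preliminaries: `ℂ`-points of separated `ℂ`-schemes are closed immersions; the fibre torus indexed by `Fin g ⊕ Fin g` -/

/-- A `ℂ`-point `P : Spec ℂ → S` of a separated `ℂ`-scheme `S` is a closed immersion (a section of the separated structure map; Mathlib
`IsClosedImmersion.of_comp`). [cite: GortzWedhorn2020, (9.3) Remark 9.11–Example 9.12] -/
theorem isClosedImmersion_left_of_complexPoint {S : SchemeOver ℂ} [IsSeparated S.hom] (P : ComplexPoints S) :
    IsClosedImmersion P.left := by
  have hP : P.left ≫ S.hom = 𝟙 (Spec (.of ℂ)) := (Over.w P).trans (specOver_self_hom ℂ)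
  haveI : IsClosedImmersion (P.left ≫ S.hom) := by
    rw [hP]; exact (inferInstance : IsClosedImmersion (𝟙 (Spec (.of ℂ))))
  exact IsClosedImmersion.of_comp P.left S.hom

/-- **The fibre torus indexed by `Fin g ⊕ Fin g`**: a complex abelian variety `B` of dimension `g` has an additive analytification by a complex torus
`ComplexTorus Φ₀`, `Φ₀ : ℝ^{Fin g ⊕ Fin g} ≃ ℂ^g` (★ (U) re-indexed along `Fintype.equivOfCardEq` through ★
`AbelianVariety.exists_uniformisation_of_basis_integralLattice`). [cite: MumfordAV1970, §1 (1)–(2)] -/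
theorem exists_uniformisation_finSum (B : AbelianVariety ℂ) {g : ℕ} (hg : B.dim = g) :
    ∃ (Φ₀ : (Fin g ⊕ Fin g → ℝ) ≃L[ℝ] (Fin g → ℂ)) (φu : ComplexTorus Φ₀ → ComplexPoints B.X),
      IsAnalytification (Fin g → ℂ) B.X g φu ∧ ∀ x y, φu (x + y) = φu x * φu y := by
  classical
  obtain ⟨ι, _, _, Ψ, φ₀, hφ₀, -⟩ := Literature.AlgebraicGeometry.HodgeTheory.complexAbelianVariety_torusUniformised_holds B
  -- `|ι| = 2 dim B = |Fin g ⊕ Fin g|`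
  have hcard : Fintype.card ι = Fintype.card (Fin g ⊕ Fin g) := by
    have h : Module.finrank ℝ (ι → ℝ) = Module.finrank ℝ (Fin B.dim → ℂ) := LinearEquiv.finrank_eq Ψ.toLinearEquiv
    rw [Module.finrank_fintype_fun_eq_card, finrank_real_of_complex, Module.finrank_fin_fun, hg] at h
    rw [h, Fintype.card_sum, Fintype.card_fin]; ring
  let e : ι ≃ Fin g ⊕ Fin g := Fintype.equivOfCardEq hcard
  -- a `ℤ`-basis of `H¹(B(ℂ); ℤ)/tors` indexed by `ι`, re-indexed along `e`
  obtain ⟨ℓ, -⟩ := Literature.AlgebraicGeometry.HodgeTheory.exists_basis_integralLattice_map_eq_latticeClass Ψ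
    ⟨φ₀, hφ₀.isHomeomorph.continuous⟩ hφ₀.isHomeomorph
  obtain ⟨Φ₀, φ, hφ, hadd, -⟩ :=
    Literature.AlgebraicGeometry.HodgeTheory.AbelianVariety.exists_uniformisation_of_basis_integralLattice B hg (ℓ.reindex e)
  refine ⟨Φ₀, φ, ?_, hadd⟩
  rw [hg] at hφ
  exact hφ

/-! ## §2 (D3): the fibre uniformisation as a holomorphic immersion into `MA` -/

/-- **(D3) FIBRE UNIFORMISATION IMMERSION** — for the prefix of P-1 and `u : MS`: a real frame `Φ₀ : ℝ^{Fin g ⊕ Fin g} ≃ ℂ^g`, a map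
`π : ℂ^g → MA` and an additive analytification `φu : ComplexTorus Φ₀ → A_{φS u}(ℂ)` of the fibre, with `π` holomorphic with injective
differential everywhere, over `u`, kernel EXACTLY `Φ₀ (ℤ^{2g})`, onto `basePoint⁻¹ u`, and `(φA (π z)).left = fibrePointToLeft _ (φu (cover Φ₀ z))`
— the `∀ u`-tail of `RoadB.DOUBLING` minus its `two`∕`zero` clauses (`π := φA⁻¹ ∘ τ(ℂ) ∘ φu ∘ cover Φ₀`, `τ` the fibre inclusion, a closed
immersion). [cite: MumfordAV1970, §1 (1)–(2); §4 (iv)] [cite: SerreGAGA1956, §2 n°5 Prop. 2, n°6 Prop. 3 Cor. 2]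
[cite: DeligneHodgeII1971, §4.4 (4.4.2) p. 50] [cite: GortzWedhorn2020, Section (4.7) (pp. 107–108)] -/
theorem exists_fibre_uniformisation_immersion
    (S : SchemeOver ℂ) (d : ℕ) [LocallyOfFiniteType S.hom] [IsSeparated S.hom] [SmoothOfRelativeDimension d S.hom]
    (A : AbelianSchemeOver S.left) (g : ℕ) (hA : A.IsOfRelDim g)
    (MS : Type) [TopologicalSpace MS] [ChartedSpace (Fin d → ℂ) MS] [IsManifold 𝓘(ℂ, Fin d → ℂ) ω MS]
    (φS : MS → ComplexPoints S) (hS : IsAnalytification (Fin d → ℂ) S d φS)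
    (MA : Type) [TopologicalSpace MA] [ChartedSpace (Fin (d + g) → ℂ) MA] [IsManifold 𝓘(ℂ, Fin (d + g) → ℂ) ω MA]
    (φA : MA → ComplexPoints (totalOver S A)) (hφA : IsAnalytification (Fin (d + g) → ℂ) (totalOver S A) (d + g) φA)
    (u : MS) :
    ∃ (Φ₀ : (Fin g ⊕ Fin g → ℝ) ≃L[ℝ] (Fin g → ℂ)) (π : (Fin g → ℂ) → MA)
        (φu : ComplexTorus Φ₀ → (A.fibre (φS u).left).toAbelianVariety.Points ℂ),
      MDifferentiable 𝓘(ℂ, Fin g → ℂ) 𝓘(ℂ, Fin (d + g) → ℂ) π ∧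
      (∀ z : Fin g → ℂ, Injective (mfderiv 𝓘(ℂ, Fin g → ℂ) 𝓘(ℂ, Fin (d + g) → ℂ) π z)) ∧
      (∀ z : Fin g → ℂ, basePoint hS A φA (π z) = u) ∧
      (∀ z z' : Fin g → ℂ, π z = π z' ↔ ∃ k : Fin g ⊕ Fin g → ℤ, z' = z + Φ₀ (fun i => (k i : ℝ))) ∧
      (∀ a : MA, basePoint hS A φA a = u → ∃ z : Fin g → ℂ, π z = a) ∧
      IsAnalytification (Fin g → ℂ) (A.fibre (φS u).left).toAbelianVariety.X g φu ∧
      (∀ x y, φu (x + y) = φu x * φu y) ∧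
      ∀ z : Fin g → ℂ, (φA (π z)).left = A.fibrePointToLeft (φS u).left (φu (cover Φ₀ z)) := by
  classical
  -- the `ℂ`-point `s = φS u` of `S` and the fibre `B := A_s`, a complex abelian variety of dimension `g`
  set s : Spec (.of ℂ) ⟶ S.left := (φS u).left with hs
  set B : AbelianVariety ℂ := (A.fibre s).toAbelianVariety with hB
  have hdim : B.dim = g := AbelianSchemeOver.dim_toAbelianVariety_of_isOfRelDim (hA.baseChange s)
  -- §1: the fibre torus indexed by `Fin g ⊕ Fin g`
  obtain ⟨Φ₀, φu, hφu, hadd⟩ := exists_uniformisation_finSum B hdim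
  -- the fibre inclusion `τ : B.X ⟶ totalOver S A` over `Spec ℂ`, a closed immersion
  have hsS : s ≫ S.hom = 𝟙 (Spec (.of ℂ)) := (Over.w (φS u)).trans (specOver_self_hom ℂ)
  have hτw : pullback.fst A.X.hom s ≫ (totalOver S A).hom = B.X.hom := by
    change pullback.fst A.X.hom s ≫ A.X.hom ≫ S.hom = pullback.snd A.X.hom s
    rw [← Category.assoc, pullback.condition, Category.assoc, hsS, Category.comp_id]
  let τ : B.X ⟶ totalOver S A := Over.homMk (pullback.fst A.X.hom s) hτw
  have hτleft : τ.left = pullback.fst A.X.hom s := rfl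
  haveI : IsClosedImmersion s := by rw [hs]; exact isClosedImmersion_left_of_complexPoint (φS u)
  haveI : IsClosedImmersion τ.left := by
    rw [hτleft]; exact MorphismProperty.pullback_fst _ _ inferInstance
  -- `map τ` on points IS `fibrePointToLeft`
  have hmapτ : ∀ P : B.Points ℂ, (AlgPoints.map τ P).left = A.fibrePointToLeft s P := fun P => rfl
  have hmapτ_inj : Injective (AlgPoints.map τ : B.Points ℂ → ComplexPoints (totalOver S A)) := by
    intro P Q h
    exact A.fibrePointToLeft_injective s ((hmapτ P).symm.trans ((congrArg (fun R => R.left) h).trans (hmapτ Q)))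
  -- smoothness ∕ finite-type instances for the two GAGA lemmas
  haveI hsmA : SmoothOfRelativeDimension g A.X.hom := (A.isOfRelDim_iff g).mp hA
  haveI : LocallyOfFiniteType A.X.hom := by haveI := A.isSmooth; infer_instance
  haveI : LocallyOfFiniteType (totalOver S A).hom := by
    change LocallyOfFiniteType (A.X.hom ≫ S.hom); infer_instance
  haveI : SmoothOfRelativeDimension (d + g) (totalOver S A).hom := by
    change SmoothOfRelativeDimension (d + g) (A.X.hom ≫ S.hom); rw [Nat.add_comm]; infer_instance
  haveI : LocallyOfFiniteType B.X.hom := inferInstance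
  haveI : SmoothOfRelativeDimension g B.X.hom := hdim ▸ B.smoothOfRelativeDimension_dim
  -- the analytified fibre inclusion `F : ComplexTorus Φ₀ → MA` and `π := F ∘ cover`
  let F : ComplexTorus Φ₀ → MA := hφA.homeomorph.symm ∘ AlgPoints.map τ ∘ φu
  have hF : φA ∘ F = AlgPoints.map τ ∘ φu := by
    funext t
    show hφA.homeomorph (hφA.homeomorph.symm (AlgPoints.map τ (φu t))) = _
    rw [Homeomorph.apply_symm_apply]; rfl
  have hFapp : ∀ t, φA (F t) = AlgPoints.map τ (φu t) := fun t => congrFun hF t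
  have hFsmooth : ContMDiff 𝓘(ℂ, Fin g → ℂ) 𝓘(ℂ, Fin (d + g) → ℂ) ω F := hφu.contMDiff_comp_map hφA τ F hF
  have hFinj : ∀ t, Injective (mfderiv 𝓘(ℂ, Fin g → ℂ) 𝓘(ℂ, Fin (d + g) → ℂ) F t) := fun t =>
    hφu.injective_mfderiv_of_isClosedImmersion hφA τ F hF t
  let π : (Fin g → ℂ) → MA := F ∘ cover Φ₀
  have hFmd : MDifferentiable 𝓘(ℂ, Fin g → ℂ) 𝓘(ℂ, Fin (d + g) → ℂ) F := hFsmooth.mdifferentiable (by simp)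
  have hπmd : MDifferentiable 𝓘(ℂ, Fin g → ℂ) 𝓘(ℂ, Fin (d + g) → ℂ) π := hFmd.comp (mdifferentiable_cover Φ₀)
  -- `F` is injective (`φA⁻¹`, `τ(ℂ)`, `φu` are)
  have hFinj' : Injective F := by
    intro t t' h
    have h1 : AlgPoints.map τ (φu t) = AlgPoints.map τ (φu t') := by rw [← hFapp, ← hFapp, h]
    exact hφu.isHomeomorph.injective (hmapτ_inj h1)
  -- the base point of `F t` is `u`
  have hbase : ∀ t, basePoint hS A φA (F t) = u := by
    intro t
    apply hS.homeomorph.injective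
    show φS (basePoint hS A φA (F t)) = φS u
    rw [apply_basePoint hS A φA (F t), hFapp]
    -- `map projOver (map τ P) = φS u` as `ℂ`-points of `S`
    apply Over.OverMorphism.ext
    change A.fibrePointToLeft s (φu t) ≫ A.X.hom = (φS u).left
    exact A.fibrePointToLeft_comp_hom s (φu t)
  refine ⟨Φ₀, π, φu, hπmd, ?_, fun z => hbase _, ?_, ?_, hφu, hadd, fun z => ?_⟩
  · -- immersion: `dπ(z) = dF(cover z) ∘ d cover(z)`, `d cover = id`
    intro z
    have hc : mfderiv 𝓘(ℂ, Fin g → ℂ) 𝓘(ℂ, Fin (d + g) → ℂ) π z =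
        (mfderiv 𝓘(ℂ, Fin g → ℂ) 𝓘(ℂ, Fin (d + g) → ℂ) F (cover Φ₀ z)).comp
          (mfderiv 𝓘(ℂ, Fin g → ℂ) 𝓘(ℂ, Fin g → ℂ) (cover Φ₀) z) :=
      mfderiv_comp z (hFmd _) (mdifferentiable_cover Φ₀ z)
    rw [hc, mfderiv_cover]
    exact (hFinj (cover Φ₀ z)).comp injective_id
  · -- kernel EXACTLY the lattice
    intro z z'
    constructor
    · intro h
      have hc : cover Φ₀ z' = cover Φ₀ z := (hFinj' h).symm
      obtain ⟨n, hn⟩ := (cover_eq_cover_iff Φ₀ z' z).mp hc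
      exact ⟨n, hn⟩
    · rintro ⟨n, rfl⟩
      show F (cover Φ₀ z) = F (cover Φ₀ (z + Φ₀ fun i => (n i : ℝ)))
      rw [(cover_eq_cover_iff Φ₀ (z + Φ₀ fun i => (n i : ℝ)) z).mpr ⟨n, rfl⟩]
  · -- onto the fibre over `u`
    intro a ha
    -- `φA a` lies over `s`
    have hover : (φA a).left ≫ A.X.hom = s := by
      have h1 : φS (basePoint hS A φA a) = AlgPoints.map (projOver S A) (φA a) := apply_basePoint hS A φA a
      rw [ha] at h1
      have h2 : (AlgPoints.map (projOver S A) (φA a)).left = (φA a).left ≫ A.X.hom := rfl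
      rw [← h1] at h2
      exact h2.symm
    obtain ⟨P, hP⟩ := A.exists_points_fibrePointToLeft_eq s (Over.homMk (φA a).left hover : A.FibrePoints s)
    have hPa : AlgPoints.map τ P = φA a := Over.OverMorphism.ext (by rw [hmapτ, hP]; rfl)
    obtain ⟨t, rfl⟩ := hφu.isHomeomorph.surjective P
    obtain ⟨z, rfl⟩ := cover_surjective Φ₀ t
    refine ⟨z, ?_⟩
    show hφA.homeomorph.symm (AlgPoints.map τ (φu (cover Φ₀ z))) = a
    rw [hPa]
    exact hφA.homeomorph.symm_apply_apply a
  · -- the (G)-reading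
    show (φA (F (cover Φ₀ z))).left = _
    rw [hFapp]
    exact hmapτ _

end Literature.Geometry.ComplexAnalytic

end
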